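import Summits.QuantumFields.YangMills.Theorems.AlphaInputsT3ACv3EMLIterFirstOrderUniform
import HarnessLib

/-!
# `AlphaInputsT3ACv3EMLTwoFieldProp3` — STRATEGY B for 2′, non-abelian (FL) input (memo v2 row R2): **THE TWO-FIELD (LIPSCHITZ) FORM OF [Balaban1985Averaging] PROP. 3 AT THE FLAT
# BACKGROUND FOR THE (0.4) AVERAGING OF RECORD** — the second-order remainder `R(U)(c) := Ū(c) − 1 − (Q₁(U−1))(c)` is LIPSCHITZ with a SMALL constant:
# `‖R(U₁)(c) − R(U₂)(c)‖ ≤ 1300·ℓ²·ρ·(ρ + δ₂)` for `‖U_i,b − 1‖ ≤ δ_i`, `‖U₁,b − U₂,b‖ ≤ ρ` — i.e. the derivative of the one-step average at ANY `δ`-small flat-gauge background is `Q₁` up to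
# `O(ℓ²δ)` — lane `pub-balaban3d` ∕ cell `ym3-torus`, seat `ym-ust-19936-w1` (g0)

WHY (HOME `ym-ust-19936-w1/NONABELIAN-FL-NEWTON-w1-g0.md` §2 R2–R3; OWNER RULING g24-№4).  The contraction that supplies the `hLift` binder needs the `k`-fold average to be C^{1,1} on the
natural scales with `k`-uniform constants (row R3); R3 is this one-step statement iterated by the device of `…v3EMLIterFirstOrderUniform`.  The one-field Prop. 3 (`‖R(U)‖ ≤ 81(ℓδ)²`,
`BlockAveragingEMLLinearised.norm_avgFun_sub_one_sub_linAvg_le`) does not control DIFFERENCES; the tree's Prop. 3 AT A BACKGROUND (`BlockAveragingEMLLinearisedBackground.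
norm_avgFun_ratio_sub_one_sub_covLinAvg_le`: `‖Ū₁Ū₂* − 1 − covLinAvg U₂ Y‖ ≤ 400ℓδ′(ℓδ′+α)`, `Y = U₁U₂⁻¹ − 1`) does, once (§2) the COVARIANT signed sums at a `δ₂`-small background are
compared with the flat ones (`‖Y_{U₂}(Γ) − Y(Γ)‖ ≤ δ₂·r·|Γ|(|Γ|+1)`: each transport `R(g_s)` moves a matrix by `≤ 2‖g_s − 1‖·‖·‖`), (§3) `covLinAvg U₂ Y` is compared with `linAvg Y` through the loop
form `…EMLSecondOrderMain.mean_walkSum_loop_add_axial_eq_linAvg`, and (§4) the ratio `Ū₁Ū₂*` is converted to the difference `Ū₁ − Ū₂` and `Y` to `U₁ − U₂`.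
WHAT IS HERE (no definition): §1 step-factor facts (`norm_stepFactor_eq_one`, `norm_stepFactor_sub_one_le'`, `norm_conj_stepFactor_sub_self_le`); §2 ★ `norm_covWalkSum_sub_walkSum_le`;
§3 ★ `norm_covLinAvg_sub_linAvg_le`; §4 ★★ `norm_rem_sub_rem_le` (the title).
HONEST FRAMING.  One (0.4) step, flat gauge; count-neutral helper toward R3 2′ (items 19936∕19935); (FL) NOT proved; registry untouched; nothing about d = 4, the continuum, or a mass gap;
YM₃ on T³ is rung R3, not Clay.

References: T. Bałaban, Commun. Math. Phys. 98 (1985) 17–51 [Balaban1985Averaging] ((56)–(58) p.27, Prop. 3 (122)–(125) p.36, Prop. 5 (156)–(157) p.42); CMP 109 (1987) 249–301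
[Balaban1987RG1] ((0.4) p.253).
-/

set_option autoImplicit false

noncomputable section

namespace Summit.QuantumFields.YangMills.Theorems.EMLTwoField

open Finset
open scoped Matrix.Norms.L2Operator
open Literature.MathematicalPhysics.QuantumFieldTheory.Balaban1983to89
open T4Continuum AveragingRT BlockAveraging ExpMeanLog BlockAveragingEMLLinearised BlockAveragingEMLLinearisedBackground
open Literature.MathematicalPhysics.QuantumFieldTheory.Balaban1983to89.LatticeWordStokes (length_loopWord_le)
open Summit.QuantumFields.YangMills.Theorems.EMLSecondOrder (mean_walkSum_loop_add_axial_eq_linAvg)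
open Summit.QuantumFields.YangMills.Theorems.Prop7AvgLinearisation (norm_linAvg_le linAvg_sub)
open Summit.QuantumFields.YangMills.Theorems.Prop7HolRatioPerStep (norm_mean_le')

variable {P : Params} {j : ℕ} {n : Type*} [Fintype n] [DecidableEq n] [Nonempty n]

/-! ## §1 Step factors of a `δ`-small background -/

/-- `‖g_s‖ = 1` and `‖g_s*‖ = 1` for the background step factors (`SU(N)` is unitary). [folklore] -/
theorem norm_stepFactor_eq_one (U₀ : GaugeField P j (Matrix.specialUnitaryGroup n ℂ)) (s : LStep P j) :
    ‖stepFactor U₀ s‖ = 1 ∧ ‖star (stepFactor U₀ s)‖ = 1 := by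
  have hu : ∀ g : Matrix.specialUnitaryGroup n ℂ, ‖(g : Matrix n n ℂ)‖ = 1 := fun g =>
    CStarRing.norm_of_mem_unitary (Matrix.mem_specialUnitaryGroup_iff.1 g.2).1
  have hus : ∀ g : Matrix.specialUnitaryGroup n ℂ, ‖star (g : Matrix n n ℂ)‖ = 1 := fun g => by
    have e : star (g : Matrix n n ℂ) = ((g⁻¹ : Matrix.specialUnitaryGroup n ℂ) : Matrix n n ℂ) := rfl
    rw [e, hu]
  unfold stepFactor
  cases s.fwd
  · simp only [Bool.false_eq_true, ↓reduceIte, star_star]; exact ⟨hus _, hu _⟩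
  · simp only [↓reduceIte]; exact ⟨hu _, hus _⟩

omit [Nonempty n] in
/-- `‖g_s − 1‖ ≤ δ₀` and `‖g_s* − 1‖ ≤ δ₀` when every background bond variable is within `δ₀` of `1`. [folklore] -/
theorem norm_stepFactor_sub_one_le' (U₀ : GaugeField P j (Matrix.specialUnitaryGroup n ℂ)) {δ₀ : ℝ}
    (hU₀ : ∀ b, ‖((U₀ b : Matrix.specialUnitaryGroup n ℂ) : Matrix n n ℂ) - 1‖ ≤ δ₀) (s : LStep P j) :
    ‖stepFactor U₀ s - 1‖ ≤ δ₀ ∧ ‖star (stepFactor U₀ s) - 1‖ ≤ δ₀ := by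
  have hs : ∀ g : Matrix.specialUnitaryGroup n ℂ, ‖star (g : Matrix n n ℂ) - 1‖ = ‖(g : Matrix n n ℂ) - 1‖ := fun g => by
    rw [← star_one (R := Matrix n n ℂ), ← star_sub, norm_star, star_one]
  unfold stepFactor
  cases s.fwd
  · simp only [Bool.false_eq_true, ↓reduceIte, star_star]; exact ⟨(hs _).le.trans (hU₀ _), hU₀ _⟩
  · simp only [↓reduceIte]; exact ⟨hU₀ _, (hs _).le.trans (hU₀ _)⟩

/-- **A TRANSPORT BY A `δ₀`-SMALL STEP FACTOR MOVES A MATRIX BY `≤ 2δ₀‖X‖`**: `‖g X g* − X‖ ≤ 2δ₀‖X‖` (`gXg* − X = (g−1)Xg* + X(g*−1)`). [cite: Balaban1985Averaging, (56) p.27 (bookkeeping)] -/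
theorem norm_conj_stepFactor_sub_self_le (U₀ : GaugeField P j (Matrix.specialUnitaryGroup n ℂ)) {δ₀ : ℝ}
    (hU₀ : ∀ b, ‖((U₀ b : Matrix.specialUnitaryGroup n ℂ) : Matrix n n ℂ) - 1‖ ≤ δ₀) (s : LStep P j) (X : Matrix n n ℂ) :
    ‖stepFactor U₀ s * X * star (stepFactor U₀ s) - X‖ ≤ 2 * δ₀ * ‖X‖ := by
  obtain ⟨h1, h1s⟩ := norm_stepFactor_eq_one U₀ s
  obtain ⟨hd, hds⟩ := norm_stepFactor_sub_one_le' U₀ hU₀ s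
  set g := stepFactor U₀ s
  have e : g * X * star g - X = (g - 1) * X * star g + X * (star g - 1) := by noncomm_ring
  rw [e]
  calc ‖(g - 1) * X * star g + X * (star g - 1)‖ ≤ ‖g - 1‖ * ‖X‖ * ‖star g‖ + ‖X‖ * ‖star g - 1‖ :=
        (norm_add_le _ _).trans (add_le_add ((norm_mul_le _ _).trans (mul_le_mul_of_nonneg_right (norm_mul_le _ _) (norm_nonneg _))) (norm_mul_le _ _))
    _ ≤ δ₀ * ‖X‖ * 1 + ‖X‖ * δ₀ := by
        rw [h1s]
        exact add_le_add (mul_le_mul_of_nonneg_right (mul_le_mul_of_nonneg_right hd (norm_nonneg _)) zero_le_one)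
          (mul_le_mul_of_nonneg_left hds (norm_nonneg _))
    _ = 2 * δ₀ * ‖X‖ := by ring

/-! ## §2 Covariant versus flat signed sums -/

/-- **★ `‖Y_{U₀}(Γ) − Y(Γ)‖ ≤ δ₀·r·|Γ|(|Γ|+1)`** when the background bond variables are within `δ₀` of `1` and `‖Y_b‖ ≤ r`: at each step the covariant term differs from the flat one by
`≤ 2δ₀r` (backward steps only) and the transport of the tail by `≤ 2δ₀·|tail|·r`. [cite: Balaban1985Averaging, (58) p.27] -/
theorem norm_covWalkSum_sub_walkSum_le (U₀ : GaugeField P j (Matrix.specialUnitaryGroup n ℂ)) {δ₀ : ℝ}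
    (hU₀ : ∀ b, ‖((U₀ b : Matrix.specialUnitaryGroup n ℂ) : Matrix n n ℂ) - 1‖ ≤ δ₀) (Y : PBond P j → Matrix n n ℂ) {r : ℝ} (hY : ∀ b, ‖Y b‖ ≤ r) :
    ∀ γ : List (LStep P j), ‖covWalkSum U₀ Y γ - walkSum Y γ‖ ≤ δ₀ * r * ((γ.length : ℝ) * ((γ.length : ℝ) + 1))
  | [] => by simp
  | s :: γ => by
    have hr : 0 ≤ r := (norm_nonneg _).trans (hY s.bond)
    have hδ₀ : 0 ≤ δ₀ := (norm_nonneg _).trans (hU₀ s.bond)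
    have ih := norm_covWalkSum_sub_walkSum_le U₀ hU₀ Y hY γ
    rw [covWalkSum_cons, walkSum_cons, List.length_cons]
    push_cast
    set g := stepFactor U₀ s with hg
    set C := covWalkSum U₀ Y γ
    set W := walkSum Y γ
    -- the step term
    have hstep : ‖covStep U₀ Y s - (if s.fwd then Y s.bond else -Y s.bond)‖ ≤ 2 * δ₀ * r := by
      unfold covStep
      cases s.fwd
      · simp only [Bool.false_eq_true, ↓reduceIte]
        rw [← hg, show -(g * Y s.bond * star g) - -Y s.bond = -(g * Y s.bond * star g - Y s.bond) by abel, norm_neg]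
        exact (norm_conj_stepFactor_sub_self_le U₀ hU₀ s _).trans (by nlinarith [hY s.bond])
      · simp only [↓reduceIte, sub_self, norm_zero]; positivity
    -- the transported tail
    have hC : ‖C‖ ≤ (γ.length : ℝ) * r := norm_covWalkSum_le U₀ hY γ
    have htail : ‖g * C * star g - W‖ ≤ 2 * δ₀ * ((γ.length : ℝ) * r) + δ₀ * r * ((γ.length : ℝ) * ((γ.length : ℝ) + 1)) := by
      have e : g * C * star g - W = (g * C * star g - C) + (C - W) := by abel
      rw [e]
      refine (norm_add_le _ _).trans (add_le_add ?_ ih)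
      exact (norm_conj_stepFactor_sub_self_le U₀ hU₀ s C).trans (by nlinarith)
    have e : covStep U₀ Y s + g * C * star g - ((if s.fwd then Y s.bond else -Y s.bond) + W) =
        (covStep U₀ Y s - (if s.fwd then Y s.bond else -Y s.bond)) + (g * C * star g - W) := by abel
    rw [e]
    refine (norm_add_le _ _).trans ((add_le_add hstep htail).trans (le_of_eq ?_))
    ring

/-! ## §3 `covLinAvg` at a `δ₀`-small background versus the flat `linAvg` -/

/-- **★ `‖(Q₁(U₀)Y)(c) − (Q₁Y)(c)‖ ≤ 2·δ₀·r·ℓ(ℓ+1)`** (`ℓ = (d+2)L`): the loop walks and the straight segment have at most `ℓ` steps; the flat loop form is `linAvg` by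
`mean_walkSum_loop_add_axial_eq_linAvg`. [cite: Balaban1985Averaging, (124)–(125) p.36] -/
theorem norm_covLinAvg_sub_linAvg_le (U₀ : GaugeField P j (Matrix.specialUnitaryGroup n ℂ)) {δ₀ : ℝ}
    (hU₀ : ∀ b, ‖((U₀ b : Matrix.specialUnitaryGroup n ℂ) : Matrix n n ℂ) - 1‖ ≤ δ₀) (Y : PBond P j → Matrix n n ℂ) {r : ℝ} (hY : ∀ b, ‖Y b‖ ≤ r)
    (c : PBond P (j + 1)) :
    ‖covLinAvg U₀ Y c - linAvg Y c‖ ≤ 2 * (δ₀ * r * ((((P.d + 2) * P.L : ℕ) : ℝ) * ((((P.d + 2) * P.L : ℕ) : ℝ) + 1))) := by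
  set ℓ : ℝ := (((P.d + 2) * P.L : ℕ) : ℝ) with hℓ
  have hr : 0 ≤ r := (norm_nonneg _).trans (hY ⟨emb c.src, c.dir⟩)
  have hδ₀ : 0 ≤ δ₀ := (norm_nonneg _).trans (hU₀ ⟨emb c.src, c.dir⟩)
  have hmono : ∀ γ : List (LStep P j), γ.length ≤ (P.d + 2) * P.L →
      ‖covWalkSum U₀ Y γ - walkSum Y γ‖ ≤ δ₀ * r * (ℓ * (ℓ + 1)) := by
    intro γ hγ
    refine (norm_covWalkSum_sub_walkSum_le U₀ hU₀ Y hY γ).trans (mul_le_mul_of_nonneg_left ?_ (mul_nonneg hδ₀ hr))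
    have h1 : (γ.length : ℝ) ≤ ℓ := by rw [hℓ]; exact_mod_cast hγ
    have h0 : (0 : ℝ) ≤ γ.length := Nat.cast_nonneg _
    nlinarith
  have hloop : ∀ i : Idx P, ‖covWalkSum U₀ Y (walk (emb c.src) (loopWord P.L c.dir (off i.1) i.2.1 i.2.2)) -
      walkSum Y (walk (emb c.src) (loopWord P.L c.dir (off i.1) i.2.1 i.2.2))‖ ≤ δ₀ * r * (ℓ * (ℓ + 1)) :=
    fun i => hmono _ ((length_walk _ _).le.trans (length_loopWord_le c i))
  have haxial : ‖covWalkSum U₀ Y (walk (emb c.src) (List.replicate P.L (c.dir, true))) - walkSum Y (walk (emb c.src) (List.replicate P.L (c.dir, true)))‖ ≤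
      δ₀ * r * (ℓ * (ℓ + 1)) := hmono _ (length_walk_replicate_le _ _ _)
  rw [covLinAvg_def, ← mean_walkSum_loop_add_axial_eq_linAvg]
  have e : ((Fintype.card (Idx P) : ℂ))⁻¹ • ∑ i : Idx P, covWalkSum U₀ Y (walk (emb c.src) (loopWord P.L c.dir (off i.1) i.2.1 i.2.2)) +
        covWalkSum U₀ Y (walk (emb c.src) (List.replicate P.L (c.dir, true))) -
      (((Fintype.card (Idx P) : ℂ))⁻¹ • ∑ i : Idx P, walkSum Y (walk (emb c.src) (loopWord P.L c.dir (off i.1) i.2.1 i.2.2)) +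
        walkSum Y (walk (emb c.src) (List.replicate P.L (c.dir, true)))) =
      ((Fintype.card (Idx P) : ℂ))⁻¹ • ∑ i : Idx P, (covWalkSum U₀ Y (walk (emb c.src) (loopWord P.L c.dir (off i.1) i.2.1 i.2.2)) -
          walkSum Y (walk (emb c.src) (loopWord P.L c.dir (off i.1) i.2.1 i.2.2))) +
        (covWalkSum U₀ Y (walk (emb c.src) (List.replicate P.L (c.dir, true))) - walkSum Y (walk (emb c.src) (List.replicate P.L (c.dir, true)))) := by
    rw [Finset.sum_sub_distrib, smul_sub]; abel
  rw [e]
  calc _ ≤ δ₀ * r * (ℓ * (ℓ + 1)) + δ₀ * r * (ℓ * (ℓ + 1)) := (norm_add_le _ _).trans (add_le_add (norm_mean_le' hloop) haxial)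
    _ = 2 * (δ₀ * r * (ℓ * (ℓ + 1))) := by ring

/-! ## §4 The two-field remainder bound -/

/-- **★★ THE SECOND-ORDER REMAINDER OF THE ONE-STEP (0.4) AVERAGE IS LIPSCHITZ WITH A SMALL CONSTANT** (flat gauge): for `SU(N)` fields `U₁, U₂` at level `j` with `‖U₂,b − 1‖ ≤ δ₂`,
`‖U₁,b − U₂,b‖ ≤ ρ`, `100ℓδ₂ ≤ 1`, `48ℓρ ≤ 1`, `2ℓρ + 2ℓδ₂ < δ_N` (`ℓ = (d+2)L`), and every coarse bond `c`,
`‖(Ū₁(c) − 1 − (Q₁(U₁−1))(c)) − (Ū₂(c) − 1 − (Q₁(U₂−1))(c))‖ ≤ 1300·ℓ²·ρ·(ρ + δ₂)`.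
Assembly: Prop. 3 at the background `U₂` (`norm_avgFun_ratio_sub_one_sub_covLinAvg_le`, `Y = U₁U₂⁻¹ − 1`, background loops `≤ 2ℓδ₂`), §3, `Y − (U₁ − U₂) = (U₁ − U₂)(U₂* − 1)`, and
`Ū₁ − Ū₂ = (Ū₁Ū₂* − 1)Ū₂`. [cite: Balaban1985Averaging, Prop. 3 (122)–(124) p.36, Prop. 5 (156)–(157) p.42] -/
theorem norm_rem_sub_rem_le (U₁ U₂ : GaugeField P j (Matrix.specialUnitaryGroup n ℂ)) {δ₂ ρ : ℝ} (hδ₂ : 0 ≤ δ₂) (hρ0 : 0 ≤ ρ)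
    (hU₂ : ∀ b, ‖((U₂ b : Matrix.specialUnitaryGroup n ℂ) : Matrix n n ℂ) - 1‖ ≤ δ₂)
    (hρ : ∀ b, ‖((U₁ b : Matrix.specialUnitaryGroup n ℂ) : Matrix n n ℂ) - ((U₂ b : Matrix.specialUnitaryGroup n ℂ) : Matrix n n ℂ)‖ ≤ ρ)
    (h100 : 100 * ((((P.d + 2) * P.L : ℕ) : ℝ) * δ₂) ≤ 1) (h48 : 48 * ((((P.d + 2) * P.L : ℕ) : ℝ) * ρ) ≤ 1)
    (hN : 2 * ((((P.d + 2) * P.L : ℕ) : ℝ) * ρ) + 2 * ((((P.d + 2) * P.L : ℕ) : ℝ) * δ₂) < deltaSU n) (c : PBond P (j + 1)) :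
    ‖(((avgFun (expMeanLogSU (n := n)) U₁ c : Matrix.specialUnitaryGroup n ℂ) : Matrix n n ℂ) - 1 -
          linAvg (fun b => ((U₁ b : Matrix.specialUnitaryGroup n ℂ) : Matrix n n ℂ) - 1) c) -
        (((avgFun (expMeanLogSU (n := n)) U₂ c : Matrix.specialUnitaryGroup n ℂ) : Matrix n n ℂ) - 1 -
          linAvg (fun b => ((U₂ b : Matrix.specialUnitaryGroup n ℂ) : Matrix n n ℂ) - 1) c)‖ ≤
      1300 * (((P.d + 2) * P.L : ℕ) : ℝ) ^ 2 * ρ * (ρ + δ₂) := by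
  -- letters
  set ℓ : ℝ := (((P.d + 2) * P.L : ℕ) : ℝ) with hℓ
  have hℓ1 : 1 ≤ ℓ := by
    rw [hℓ]
    have h1 : 1 ≤ (P.d + 2) * P.L := Nat.one_le_iff_ne_zero.mpr (Nat.mul_ne_zero (by omega) (by have := P.hL.2; omega))
    exact_mod_cast h1
  have hℓ0 : 0 ≤ ℓ := by linarith
  set A₁ : Matrix n n ℂ := ((avgFun (expMeanLogSU (n := n)) U₁ c : Matrix.specialUnitaryGroup n ℂ) : Matrix n n ℂ) with hA₁
  set A₂ : Matrix n n ℂ := ((avgFun (expMeanLogSU (n := n)) U₂ c : Matrix.specialUnitaryGroup n ℂ) : Matrix n n ℂ) with hA₂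
  set Y : PBond P j → Matrix n n ℂ := pertVar U₂ U₁ with hYdef
  set V₁ : PBond P j → Matrix n n ℂ := fun b => ((U₁ b : Matrix.specialUnitaryGroup n ℂ) : Matrix n n ℂ) - 1 with hV₁
  set V₂ : PBond P j → Matrix n n ℂ := fun b => ((U₂ b : Matrix.specialUnitaryGroup n ℂ) : Matrix n n ℂ) - 1 with hV₂
  -- unitary facts
  have hmem : ∀ g : Matrix.specialUnitaryGroup n ℂ, (g : Matrix n n ℂ) ∈ Matrix.unitaryGroup n ℂ := fun g =>
    (Matrix.mem_specialUnitaryGroup_iff.1 g.2).1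
  have hnorm1 : ∀ g : Matrix.specialUnitaryGroup n ℂ, ‖(g : Matrix n n ℂ)‖ = 1 := fun g => CStarRing.norm_of_mem_unitary (hmem g)
  have hnorms : ∀ g : Matrix.specialUnitaryGroup n ℂ, ‖star (g : Matrix n n ℂ)‖ = 1 := fun g => by
    have e : star (g : Matrix n n ℂ) = ((g⁻¹ : Matrix.specialUnitaryGroup n ℂ) : Matrix n n ℂ) := rfl
    rw [e, hnorm1]
  have hstar1 : ∀ g : Matrix.specialUnitaryGroup n ℂ, ‖star (g : Matrix n n ℂ) - 1‖ = ‖(g : Matrix n n ℂ) - 1‖ := fun g => by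
    rw [← star_one (R := Matrix n n ℂ), ← star_sub, norm_star, star_one]
  -- (1) `Y_b = (U₁,b − U₂,b)·U₂,b*`, `‖Y_b‖ ≤ ρ`, `‖Y_b − (U₁,b − U₂,b)‖ ≤ ρδ₂`
  have hYeq : ∀ b, Y b = (((U₁ b : Matrix.specialUnitaryGroup n ℂ) : Matrix n n ℂ) - ((U₂ b : Matrix.specialUnitaryGroup n ℂ) : Matrix n n ℂ)) *
      star ((U₂ b : Matrix.specialUnitaryGroup n ℂ) : Matrix n n ℂ) := fun b => by
    rw [hYdef, pertVar_eq, sub_mul, Unitary.mul_star_self_of_mem (hmem (U₂ b))]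
  have hYρ : ∀ b, ‖Y b‖ ≤ ρ := fun b => by
    rw [hYeq]
    exact (norm_mul_le _ _).trans (by rw [hnorms, mul_one]; exact hρ b)
  have hYV : ∀ b, ‖Y b - (V₁ b - V₂ b)‖ ≤ ρ * δ₂ := fun b => by
    have e : Y b - (V₁ b - V₂ b) = (((U₁ b : Matrix.specialUnitaryGroup n ℂ) : Matrix n n ℂ) - ((U₂ b : Matrix.specialUnitaryGroup n ℂ) : Matrix n n ℂ)) *
        (star ((U₂ b : Matrix.specialUnitaryGroup n ℂ) : Matrix n n ℂ) - 1) := by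
      rw [hYeq, hV₁, hV₂]; noncomm_ring
    rw [e]
    exact (norm_mul_le _ _).trans (mul_le_mul (hρ b) (by rw [hstar1]; exact hU₂ b) (norm_nonneg _) hρ0)
  -- (2) background loops of `U₂` within `2ℓδ₂`
  have hloops : ∀ i : Idx P, dist1 (loopHol U₂ c i) ≤ 2 * ℓ * δ₂ := fun i => by
    show ‖((holAt U₂ (walk (emb c.src) (loopWord P.L c.dir (off i.1) i.2.1 i.2.2)) : Matrix.specialUnitaryGroup n ℂ) : Matrix n n ℂ) - 1‖ ≤ _
    have hm : ((((P.d + 2) * P.L : ℕ)) : ℝ) * δ₂ ≤ 1 / 2 := by rw [← hℓ]; nlinarith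
    have h := norm_holAt_sub_one_le_of_length_le U₂ hδ₂ hU₂ hm (walk (emb c.src) (loopWord P.L c.dir (off i.1) i.2.1 i.2.2))
      ((length_walk _ _).le.trans (length_loopWord_le c i))
    rw [← hℓ] at h
    exact h
  -- (3) Prop. 3 at the background `U₂`
  have h48' : 48 * (ℓ * ρ) ≤ 1 := h48
  have hα24 : 2 * ℓ * δ₂ ≤ 1 / 24 := by nlinarith
  have hN' : 2 * (ℓ * ρ) + 2 * ℓ * δ₂ < deltaSU n := by linarith
  have E1 : ‖A₁ * star A₂ - 1 - covLinAvg U₂ Y c‖ ≤ 400 * (ℓ * ρ) * (ℓ * ρ + 2 * ℓ * δ₂) :=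
    norm_avgFun_ratio_sub_one_sub_covLinAvg_le U₂ U₁ hρ0 hYρ h48' c hloops hα24 hN'
  -- (4) `covLinAvg U₂ Y` versus `linAvg Y`
  have E2 : ‖covLinAvg U₂ Y c - linAvg Y c‖ ≤ 4 * ℓ ^ 2 * δ₂ * ρ := by
    have h := norm_covLinAvg_sub_linAvg_le U₂ hU₂ Y hYρ c
    rw [← hℓ] at h
    refine h.trans ?_
    nlinarith [mul_nonneg (mul_nonneg hδ₂ hρ0) hℓ0]
  -- (5) `linAvg Y` versus `linAvg (U₁ − 1) − linAvg (U₂ − 1)`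
  have E3 : ‖linAvg Y c - (linAvg V₁ c - linAvg V₂ c)‖ ≤ 3 * ℓ * (ρ * δ₂) := by
    rw [← linAvg_sub, ← linAvg_sub]
    exact norm_linAvg_le _ (mul_nonneg hρ0 hδ₂) hYV c
  -- (6) sizes of `A₂ − 1` and of `covLinAvg`
  have hA₂1 : ‖A₂ - 1‖ ≤ 4 * ℓ * δ₂ := by
    have h16 : 16 * ((((P.d + 2) * P.L : ℕ) : ℝ) * δ₂) ≤ 1 := by rw [← hℓ]; linarith
    have hN₂ : 2 * ((((P.d + 2) * P.L : ℕ) : ℝ) * δ₂) < deltaSU n := by rw [← hℓ]; nlinarith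
    have h1 := norm_avgFun_sub_one_sub_linAvg_le (n := n) U₂ hδ₂ hU₂ h16 hN₂ c
    rw [← hℓ] at h1
    have h2 : ‖linAvg V₂ c‖ ≤ 3 * ℓ * δ₂ := norm_linAvg_le _ hδ₂ hU₂ c
    have e : A₂ - 1 = (A₂ - 1 - linAvg V₂ c) + linAvg V₂ c := by abel
    rw [e]
    refine (norm_add_le _ _).trans ?_
    nlinarith [mul_nonneg hℓ0 hδ₂]
  have hcov : ‖covLinAvg U₂ Y c‖ ≤ 3 * ℓ * ρ + 4 * ℓ ^ 2 * δ₂ * ρ := by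
    have h1 : ‖linAvg Y c‖ ≤ 3 * ℓ * ρ := norm_linAvg_le _ hρ0 hYρ c
    have e : covLinAvg U₂ Y c = (covLinAvg U₂ Y c - linAvg Y c) + linAvg Y c := by abel
    rw [e]
    exact (norm_add_le _ _).trans (by linarith)
  -- (7) ratio to difference: `A₁ − A₂ = (A₁A₂* − 1)A₂`
  have hA₂n : ‖A₂‖ = 1 := hnorm1 _
  have hdiff : ‖A₁ - A₂ - covLinAvg U₂ Y c‖ ≤ 400 * (ℓ * ρ) * (ℓ * ρ + 2 * ℓ * δ₂) + (3 * ℓ * ρ + 4 * ℓ ^ 2 * δ₂ * ρ) * (4 * ℓ * δ₂) := by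
    have e : A₁ - A₂ - covLinAvg U₂ Y c = (A₁ * star A₂ - 1 - covLinAvg U₂ Y c) * A₂ + covLinAvg U₂ Y c * (A₂ - 1) := by
      have hs : star A₂ * A₂ = 1 := Unitary.star_mul_self_of_mem (hmem _)
      have e1 : (A₁ * star A₂ - 1 - covLinAvg U₂ Y c) * A₂ = A₁ * (star A₂ * A₂) - A₂ - covLinAvg U₂ Y c * A₂ := by noncomm_ring
      rw [e1, hs]; noncomm_ring
    rw [e]
    refine (norm_add_le _ _).trans (add_le_add ?_ ?_)
    · exact (norm_mul_le _ _).trans (by rw [hA₂n, mul_one]; exact E1)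
    · exact (norm_mul_le _ _).trans (mul_le_mul hcov hA₂1 (norm_nonneg _) (by positivity))
  -- (8) assembly
  have e : (A₁ - 1 - linAvg V₁ c) - (A₂ - 1 - linAvg V₂ c) =
      (A₁ - A₂ - covLinAvg U₂ Y c) + (covLinAvg U₂ Y c - linAvg Y c) + (linAvg Y c - (linAvg V₁ c - linAvg V₂ c)) := by abel
  rw [e]
  have hsum := (norm_add_le _ _).trans (add_le_add ((norm_add_le _ _).trans (add_le_add hdiff E2)) E3)
  refine hsum.trans ?_
  have hu : ℓ * δ₂ ≤ 1 / 100 := by linarith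
  have hρℓ : 0 ≤ ℓ * ρ := mul_nonneg hℓ0 hρ0
  nlinarith [mul_nonneg hρℓ hδ₂, mul_nonneg (mul_nonneg hρℓ hδ₂) hℓ0, mul_nonneg (mul_nonneg hρℓ hδ₂) (mul_nonneg hℓ0 hδ₂),
    mul_nonneg hρℓ hρ0, mul_nonneg (mul_nonneg hρℓ hρ0) hℓ0]

end Summit.QuantumFields.YangMills.Theorems.EMLTwoField

end
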